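import Mathlib
import Literature.Analysis.FluidPDE.Tao2016AveragedNS.BoundedEternalSolutions
import Summits.NavierStokesRegularity.NavierStokesRegularity.Theorems.TaoLadderRungTwoBreakBlowupRigidityOneViscousEnergyBound
import HarnessLib

/-!
# Sub-(S₁) fronts do not survive NS-scaled dissipation: a `ν̂`-viscous cascade flow under a geometric
  amplitude ceiling `‖x_j(t)‖ ≤ B ν^j` with `(1+ε₀) ν² < 1` is (4.5)-regular, so the viscous companions of
  a ROBUST blow-up admit NO such ceiling — the lower edge `(1+ε₀)⁻¹ ≤ ν²` of the amplitude window in the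
  front bundle of `stub_eternalFromBlowup` (K2(1) `TaoLadderRungTwoBreak.BlowupRigidityOne`,
  stmt-NavierStokesRegularity-20206) is a THEOREM for every positive viscosity

MODEL lattice ODEs only (Tao 2016 §4: the NS-scaled viscous lattice displayed before Theorem 4.2, general
structure constants; (4.3); Lemma 4.1 (4.5)); nothing here is a statement about the Navier–Stokes equations;
NO item is closed (`--supports stmt-NavierStokesRegularity-20206`). Route-independent, general `m`, DEF-FREE.

WHY (the `a = 1` calibration of the item). `NoGlobalCascade` forbids global pseudo-solutions for EVERY defect
budget, and a global regular `ν̂`-viscous solution is a `(ν̂√2, 0)`-pseudo-solution; so robust blow-up survives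
small NS-scaled dissipation (`maximalViscousFlow_of_noGlobalCascade`). The cell's heuristic (S) — «a front
with per-shell energy retention `μ` survives NS-scaled dissipation iff `λμ > 1`», i.e. `μ ≥ (1+ε₀)⁻¹`,
exponent `a = 1` — is made a theorem in its conditional (regularity-criterion) form:

* `norm_shellVec_le_of_dampedShell` — ONE DAMPED SHELL: shell `k` starts at `0`, the shell below stays `≤ β`,
  the shell above `≤ γ` with `2Λ^k C_A γ ≤ ν̂(1+ε₀)^{2k}` (`C_A = shiftConst α (0,0,1)`) ⇒ `‖x_k(t)‖ ≤
  2Λ^{k-1} C_A β²/(ν̂(1+ε₀)^{2k})` (barrier comparison for `‖x_k‖²` via `viscousShellEnergy_hasDerivWithinAt`);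
* `weight45_bounded_of_subcriticalCeiling` — THE CRITERION: a `ν̂ > 0` flow on `[0,T)` from a one-shell datum
  at shell `0`, no shells below `0`, under `‖x_j(t)‖ ≤ B ν^j` with `(1+ε₀) ν² < 1`, has bounded (4.5) norm.
  With `θ = Λ/(1+ε₀)² = (1+ε₀)^{1/2}`, `ρ = θν < 1`: dissipation dominates the back-reaction once
  `2(C_A+1)Bν ρ^k ≤ ν̂`, then `a_k ≤ c₀ θ^k a_{k-1}²` (`c₀ = 2(C_A+1)/(ν̂Λ)`) and the normalised amplitudes
  `c₀θ^{k+2}a_k` square at each step from a seed `≤ min(1, θ(1+ε₀)^{-10})`, so they decay faster than the (4.5)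
  weight grows (sharp for the argument: at `(1+ε₀)ν² = 1` the ratio back-reaction/dissipation is constant in `k`);
* `noSubcriticalCeiling_of_noGlobalCascade` — ROBUST BLOW-UP ⇒ for every `0 < ν̂ ≤ κ/√2` the maximal `ν̂`-viscous
  flow exceeds EVERY envelope `B ν^j` with `(1+ε₀)ν² < 1` (`∃ j t, B ν^j < ‖x_j(t)‖`), i.e.
  `limsup_j sup_t ‖x_j‖^{1/j} ≥ (1+ε₀)^{-1/2}`: in the currency of the front bundle (`…FrontBundle`, `…ActionSplit`:
  ceiling `B ν^j` WITH `(1+ε₀)⁻¹ ≤ ν²`) the complementary regime `ν² < (1+ε₀)⁻¹` is EXCLUDED for viscous companions.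

Nearest literature: Cheskidov 2008 (dyadic NSE, dissipation exponent `α`: local regularity `α > 1/3`, global
`α ≥ 1/2`; this lattice is the sign-indefinite `m`-vector analogue at `α = 2/5`; an a-priori envelope strictly
above the critical decay `(1+ε₀)^{-j/2}` is what is converted into regularity here). HONEST LABEL: a conditional
regularity criterion and its contrapositive along robust blow-ups; the inviscid exact flow (`ν̂ = 0`) is not
covered; `stub_eternalFromBlowup` / `stub_eternalIsDSS` are NOT proved; no crux or summit is proved; rung 0.
-/

noncomputable section

-- the summit and its single sub-problem share the name (CONVENTIONS §1)
set_option linter.dupNamespace false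

open Set Filter Topology
open scoped RealInnerProductSpace

namespace Summit.NavierStokesRegularity.NavierStokesRegularity.Theorems

namespace BlowupRigidityOne

open Literature.Analysis.FluidPDE Literature.Analysis.FluidPDE.TaoCascade

variable {m : ℕ}

/-- **ONE DAMPED SHELL (quasi-static bound).** `ε₀ > 0`, `ν̂ > 0`, `α` cancelling; shell `k` of `X` obeys the
`ν̂`-viscous law on `[0,T)` (derivatives within `[0,∞)`), starts from `x_k(0) = 0`, and on `[0,T)` the neighbours
satisfy `‖x_{k-1}‖ ≤ β`, `‖x_{k+1}‖ ≤ γ` with `2Λ^k C_A γ ≤ ν̂(1+ε₀)^{2k}` (`C_A = shiftConst α (0,0,1)`: back-reaction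
dominated by dissipation). Then `‖x_k(t)‖ ≤ 2Λ^{k-1}C_A β²/(ν̂(1+ε₀)^{2k})` on `[0,T)`: the energy `e = ‖x_k‖²` has
one-sided derivative `≤ 2F√e - De` (`F = Λ^{k-1}C_Aβ²`, `D = ν̂(1+ε₀)^{2k}`), negative on every level `√e > 2F/D`.
[cite: Tao2016AveragedNS, §4 (4.3) and the viscous equation before Thm. 4.2; Cheskidov2008, §4 (dissipation versus transfer, shell by shell)] -/
theorem norm_shellVec_le_of_dampedShell {ε₀ visc T β γ : ℝ} (hε : 0 < ε₀) (hvisc : 0 < visc)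
    {α : Fin m → Fin m → Fin m → ℤ × ℤ × ℤ → ℝ} (hc : IsCancellingCoeff α)
    {X : Fin m → ℤ → ℝ → ℝ} {k : ℤ}
    (hder : ∀ i, ∀ t ∈ Ico (0 : ℝ) T, HasDerivWithinAt (X i k)
      (quadTerm ε₀ α X i k t - visc * (1 + ε₀) ^ ((2 : ℝ) * k) * X i k t) (Ici 0) t)
    (h0 : shellVec X k 0 = 0)
    (hβ : ∀ t ∈ Ico (0 : ℝ) T, ‖shellVec X (k - 1) t‖ ≤ β)
    (hγ : ∀ t ∈ Ico (0 : ℝ) T, ‖shellVec X (k + 1) t‖ ≤ γ)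
    (hdamp : 2 * bigLam ε₀ ^ k * shiftConst α (0, 0, 1) * γ ≤ visc * (1 + ε₀) ^ ((2 : ℝ) * k)) :
    ∀ t ∈ Ico (0 : ℝ) T, ‖shellVec X k t‖ ≤
      2 * (bigLam ε₀ ^ (k - 1) * shiftConst α (0, 0, 1) * β ^ 2) / (visc * (1 + ε₀) ^ ((2 : ℝ) * k)) := by
  intro t₁ ht₁
  have hΛ : 0 < bigLam ε₀ := bigLam_pos (by linarith)
  have hC : 0 ≤ shiftConst α (0, 0, 1) := shiftConst_nonneg α _
  have hderiv : ∀ s ∈ Ico (0 : ℝ) T, HasDerivWithinAt (fun s => ‖shellVec X k s‖ ^ 2)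
      (2 * bigLam ε₀ ^ (k - 1) * ⟪shellVec X k s, tableA α (shellVec X (k - 1) s)⟫
        - 2 * bigLam ε₀ ^ k * ⟪shellVec X (k + 1) s, tableA α (shellVec X k s)⟫
        - 2 * (visc * (1 + ε₀) ^ ((2 : ℝ) * k)) * ‖shellVec X k s‖ ^ 2) (Ici 0) s := fun s hs =>
    viscousShellEnergy_hasDerivWithinAt hε hc (fun i => hder i s hs)
  set D : ℝ := visc * (1 + ε₀) ^ ((2 : ℝ) * k) with hD_def
  have hD : 0 < D := mul_pos hvisc (Real.rpow_pos_of_pos (by linarith) _)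
  set F : ℝ := bigLam ε₀ ^ (k - 1) * shiftConst α (0, 0, 1) * β ^ 2 with hF_def
  have hF : 0 ≤ F := by positivity
  refine le_of_forall_pos_lt_add fun η hη => ?_
  set s₀ : ℝ := 2 * F / D + η / 2 with hs₀_def
  have hs₀ : 0 < s₀ := by positivity
  have hcont : ContinuousOn (fun s => ‖shellVec X k s‖ ^ 2) (Icc 0 t₁) := by
    intro s hs
    have hs' : s ∈ Ico (0 : ℝ) T := ⟨hs.1, lt_of_le_of_lt hs.2 ht₁.2⟩
    exact (hderiv s hs').continuousWithinAt.mono fun x hx => hx.1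
  have hder' : ∀ s ∈ Ico (0 : ℝ) t₁, HasDerivWithinAt (fun s => ‖shellVec X k s‖ ^ 2)
      (2 * bigLam ε₀ ^ (k - 1) * ⟪shellVec X k s, tableA α (shellVec X (k - 1) s)⟫
        - 2 * bigLam ε₀ ^ k * ⟪shellVec X (k + 1) s, tableA α (shellVec X k s)⟫
        - 2 * D * ‖shellVec X k s‖ ^ 2) (Ici s) s := fun s hs =>
    (hderiv s ⟨hs.1, hs.2.trans ht₁.2⟩).mono fun x hx => le_trans hs.1 hx
  have ha : (fun s => ‖shellVec X k s‖ ^ 2) 0 ≤ s₀ ^ 2 := by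
    show ‖shellVec X k 0‖ ^ 2 ≤ s₀ ^ 2
    rw [h0, norm_zero, zero_pow two_ne_zero]
    positivity
  have hbound : ∀ s ∈ Ico (0 : ℝ) t₁, (fun s => ‖shellVec X k s‖ ^ 2) s = (fun _ => s₀ ^ 2) s →
      2 * bigLam ε₀ ^ (k - 1) * ⟪shellVec X k s, tableA α (shellVec X (k - 1) s)⟫
        - 2 * bigLam ε₀ ^ k * ⟪shellVec X (k + 1) s, tableA α (shellVec X k s)⟫
        - 2 * D * ‖shellVec X k s‖ ^ 2 < (fun _ => (0 : ℝ)) s := by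
    intro s hs heq
    have hsT : s ∈ Ico (0 : ℝ) T := ⟨hs.1, hs.2.trans ht₁.2⟩
    have hnorm : ‖shellVec X k s‖ = s₀ := (pow_left_inj₀ (norm_nonneg _) hs₀.le two_ne_zero).1 heq
    have h1 : 2 * bigLam ε₀ ^ (k - 1) * ⟪shellVec X k s, tableA α (shellVec X (k - 1) s)⟫ ≤
        2 * F * s₀ := by
      have hi := real_inner_le_norm (shellVec X k s) (tableA α (shellVec X (k - 1) s))
      have hA : ‖tableA α (shellVec X (k - 1) s)‖ ≤ shiftConst α (0, 0, 1) * β ^ 2 :=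
        (norm_tableA_le α _).trans (mul_le_mul_of_nonneg_left
          (pow_le_pow_left₀ (norm_nonneg _) (hβ s hsT) 2) hC)
      have h2 : ⟪shellVec X k s, tableA α (shellVec X (k - 1) s)⟫ ≤ s₀ * (shiftConst α (0, 0, 1) * β ^ 2) := by
        rw [← hnorm]
        exact hi.trans (mul_le_mul_of_nonneg_left hA (norm_nonneg _))
      have h3 := mul_le_mul_of_nonneg_left h2 (by positivity : (0 : ℝ) ≤ 2 * bigLam ε₀ ^ (k - 1))
      calc 2 * bigLam ε₀ ^ (k - 1) * ⟪shellVec X k s, tableA α (shellVec X (k - 1) s)⟫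
          ≤ 2 * bigLam ε₀ ^ (k - 1) * (s₀ * (shiftConst α (0, 0, 1) * β ^ 2)) := h3
        _ = 2 * F * s₀ := by rw [hF_def]; ring
    have h2 : -(2 * bigLam ε₀ ^ k * ⟪shellVec X (k + 1) s, tableA α (shellVec X k s)⟫) ≤ D * s₀ ^ 2 := by
      have hi := abs_real_inner_le_norm (shellVec X (k + 1) s) (tableA α (shellVec X k s))
      have hA : ‖tableA α (shellVec X k s)‖ ≤ shiftConst α (0, 0, 1) * s₀ ^ 2 := by
        rw [← hnorm]; exact norm_tableA_le α _
      have h3 : |⟪shellVec X (k + 1) s, tableA α (shellVec X k s)⟫| ≤ γ * (shiftConst α (0, 0, 1) * s₀ ^ 2) :=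
        hi.trans (mul_le_mul (hγ s hsT) hA (norm_nonneg _) ((norm_nonneg _).trans (hγ s hsT)))
      have h4 : -(⟪shellVec X (k + 1) s, tableA α (shellVec X k s)⟫) ≤ γ * (shiftConst α (0, 0, 1) * s₀ ^ 2) :=
        (neg_le_abs _).trans h3
      have h5 := mul_le_mul_of_nonneg_left h4 (by positivity : (0 : ℝ) ≤ 2 * bigLam ε₀ ^ k)
      have h6 : 2 * bigLam ε₀ ^ k * (γ * (shiftConst α (0, 0, 1) * s₀ ^ 2)) =
          (2 * bigLam ε₀ ^ k * shiftConst α (0, 0, 1) * γ) * s₀ ^ 2 := by ring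
      have h7 := mul_le_mul_of_nonneg_right hdamp (by positivity : (0 : ℝ) ≤ s₀ ^ 2)
      linarith [h5, h6, h7]
    have h3 : 2 * D * ‖shellVec X k s‖ ^ 2 = 2 * D * s₀ ^ 2 := by rw [hnorm]
    have h4 : D * s₀ = 2 * F + D * (η / 2) := by rw [hs₀_def]; field_simp
    have h5 : 0 < D * (η / 2) * s₀ := by positivity
    show _ < (0 : ℝ)
    nlinarith [h1, h2, h3, h4, h5]
  have key := image_le_of_deriv_right_lt_deriv_boundary hcont hder' ha
    (fun x => hasDerivAt_const x (s₀ ^ 2)) hbound (right_mem_Icc.2 ht₁.1)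
  have hle : ‖shellVec X k t₁‖ ≤ s₀ := (pow_le_pow_iff_left₀ (norm_nonneg _) hs₀.le two_ne_zero).1 key
  rw [show 2 * (bigLam ε₀ ^ (k - 1) * shiftConst α (0, 0, 1) * β ^ 2) / D = 2 * F / D by rw [hF_def]]
  linarith

set_option maxHeartbeats 400000 in
/-- **THE REGULARITY CRITERION: a sub-(S₁) geometric amplitude ceiling keeps a viscous flow (4.5)-regular.**
`ε₀ > 0`, `ν̂ > 0`, `α` cancelling; `X` a `ν̂`-viscous flow on `[0,T)` (`C¹`, motion `∂ₜX = quadTerm(X) -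
ν̂(1+ε₀)^{2n}X` within `[0,∞)`) from the one-shell datum `X₀` at shell `0`, no shells below `0`. If `‖x_j(t)‖ ≤ B ν^j`
for all `j`, `t` with `0 < ν`, `(1+ε₀) ν² < 1` — an envelope decaying STRICTLY FASTER than the (S₁) rate
`(1+ε₀)^{-j/2}` — then `sup_{i,n}(1+(1+ε₀)^{10n})|X_{i,n}(t)|` is bounded uniformly on `[0,T)`.
[cite: Tao2016AveragedNS, §4 Lemma 4.1 (4.5) and the viscous equation before Thm. 4.2; Cheskidov2008, §4 Thm. 4.3–4.4 (regularity above the critical dissipation exponent for the dyadic model; analogy)] -/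
theorem weight45_bounded_of_subcriticalCeiling {ε₀ visc T B ν : ℝ} (hε : 0 < ε₀) (hvisc : 0 < visc)
    {α : Fin m → Fin m → Fin m → ℤ × ℤ × ℤ → ℝ} (hc : IsCancellingCoeff α)
    {X : Fin m → ℤ → ℝ → ℝ} {X₀ : Fin m → ℝ}
    (hC1 : ∀ i n, ContDiffOn ℝ 1 (X i n) (Set.Ico 0 T))
    (hinit : ∀ i n, X i n 0 = if n = 0 then X₀ i else 0)
    (hlow : ∀ i n t, n < 0 → X i n t = 0)
    (hmot : ∀ i n t, 0 ≤ t → t < T → derivWithin (X i n) (Set.Ici 0) t =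
      quadTerm ε₀ α X i n t - visc * (1 + ε₀) ^ ((2 : ℝ) * n) * X i n t)
    (hν : 0 < ν) (hsub : (1 + ε₀) * ν ^ 2 < 1)
    (hamp : ∀ (j : ℤ) (t : ℝ), 0 ≤ t → t < T → ‖shellVec X j t‖ ≤ B * ν ^ j) :
    ∃ M : ℝ, ∀ t : ℝ, 0 ≤ t → t < T → ∀ (i : Fin m) (n : ℤ),
      (1 + (1 + ε₀) ^ ((10 : ℝ) * n)) * |X i n t| ≤ M := by
  rcases le_or_gt T 0 with hT | hT
  · exact ⟨0, fun t ht htT => absurd (lt_of_le_of_lt ht htT) (not_lt.2 hT)⟩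
  have hb : (0 : ℝ) < 1 + ε₀ := by linarith
  have hΛ : 0 < bigLam ε₀ := bigLam_pos (by linarith)
  have hB : 0 ≤ B := by
    have h := hamp 0 0 le_rfl hT
    rw [zpow_zero, mul_one] at h
    exact (norm_nonneg _).trans h
  have hν1 : ν ≤ 1 := by
    by_contra h; push Not at h
    nlinarith [one_lt_pow₀ h (two_ne_zero)]
  set P : ℝ := (1 + ε₀) ^ 2 with hP_def
  have hP : 0 < P := by positivity
  set θ : ℝ := bigLam ε₀ / P with hθ_def
  have hθ : 0 < θ := div_pos hΛ hP
  have hθsq : θ ^ 2 = 1 + ε₀ := by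
    rw [hθ_def, div_pow, bigLam_sq hε.le, hP_def]
    field_simp
  have hΛθ : bigLam ε₀ = θ * P := by rw [hθ_def]; field_simp
  set ρ : ℝ := θ * ν with hρ_def
  have hρ : 0 < ρ := mul_pos hθ hν
  have hρ1 : ρ < 1 := by
    have h2 : ρ ^ 2 < 1 := by rw [hρ_def, mul_pow, hθsq]; exact hsub
    by_contra h; push Not at h
    linarith [one_le_pow₀ (M₀ := ℝ) (n := 2) h]
  set C : ℝ := shiftConst α (0, 0, 1) + 1 with hC_def
  have hC0 : 0 ≤ shiftConst α (0, 0, 1) := shiftConst_nonneg α _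
  have hSC : shiftConst α (0, 0, 1) ≤ C := by rw [hC_def]; linarith
  have hC : 0 < C := lt_of_le_of_lt hC0 (by rw [hC_def]; linarith)
  set c₀ : ℝ := 2 * C / (visc * bigLam ε₀) with hc₀_def
  have hc₀ : 0 < c₀ := by positivity
  set W : ℝ := (1 + ε₀) ^ 10 with hW_def
  have hW : 1 ≤ W := one_le_pow₀ (by linarith)
  have hW0 : 0 < W := by positivity
  set δ : ℝ := min 1 (θ / W) with hδ_def
  have hδ : 0 < δ := lt_min one_pos (by positivity)
  have hδ1 : δ ≤ 1 := min_le_left _ _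
  have hδW : W * δ ≤ θ := by
    calc W * δ ≤ W * (θ / W) := mul_le_mul_of_nonneg_left (min_le_right _ _) hW0.le
      _ = θ := by field_simp
  -- power bookkeeping: `(1+ε₀)^{2k} = P^k`, `(1+ε₀)^{10k} = W^k` on natural shells
  have hPk : ∀ k : ℕ, (1 + ε₀) ^ ((2 : ℝ) * ((k : ℤ) : ℝ)) = P ^ k := fun k => by
    rw [Int.cast_natCast, Real.rpow_mul hb.le, Real.rpow_two, Real.rpow_natCast]
  have hWk : ∀ k : ℕ, (1 + ε₀) ^ ((10 : ℝ) * ((k : ℤ) : ℝ)) = W ^ k := fun k => by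
    rw [Int.cast_natCast, Real.rpow_mul hb.le, show (10 : ℝ) = ((10 : ℕ) : ℝ) by norm_num,
      Real.rpow_natCast, Real.rpow_natCast]
  -- choice of the starting shell `k₁`: dissipation dominates for `k ≥ k₁`, and the seed is below `δ`
  obtain ⟨k₁, hk₁1, hk₁damp, hk₁seed⟩ : ∃ k₁ : ℕ, 1 ≤ k₁ ∧
      (∀ k : ℕ, k₁ ≤ k → 2 * C * B * ν * ρ ^ k ≤ visc) ∧ c₀ * θ ^ 2 * B * ρ ^ k₁ ≤ δ := by
    set η : ℝ := min (visc / (2 * C * B * ν + 1)) (δ / (c₀ * θ ^ 2 * B + 1)) with hη_def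
    have hden1 : 0 < 2 * C * B * ν + 1 := by positivity
    have hden2 : 0 < c₀ * θ ^ 2 * B + 1 := by positivity
    have hη : 0 < η := lt_min (div_pos hvisc hden1) (div_pos hδ hden2)
    obtain ⟨N, hN⟩ := exists_pow_lt_of_lt_one hη hρ1
    have hρk : ∀ k : ℕ, N ≤ k → ρ ^ k ≤ η := fun k hk =>
      (pow_le_pow_of_le_one hρ.le hρ1.le hk).trans hN.le
    refine ⟨N + 1, Nat.le_add_left 1 N, fun k hk => ?_, ?_⟩
    · have h1 : ρ ^ k ≤ visc / (2 * C * B * ν + 1) := (hρk k (by omega)).trans (min_le_left _ _)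
      have h2 : (2 * C * B * ν + 1) * ρ ^ k ≤ visc := by
        rw [← le_div_iff₀' hden1]; exact h1
      nlinarith [pow_nonneg hρ.le k]
    · have h1 : ρ ^ (N + 1) ≤ δ / (c₀ * θ ^ 2 * B + 1) := (hρk (N + 1) (by omega)).trans (min_le_right _ _)
      have h2 : (c₀ * θ ^ 2 * B + 1) * ρ ^ (N + 1) ≤ δ := by
        rw [← le_div_iff₀' hden2]; exact h1
      nlinarith [pow_nonneg hρ.le (N + 1)]
  have hder : ∀ i k, ∀ τ ∈ Ico (0 : ℝ) T, HasDerivWithinAt (X i k)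
      (quadTerm ε₀ α X i k τ - visc * (1 + ε₀) ^ ((2 : ℝ) * k) * X i k τ) (Ici 0) τ := by
    intro i k τ hτ
    have hd : DifferentiableWithinAt ℝ (X i k) (Ico 0 T) τ :=
      ((hC1 i k).differentiableOn one_ne_zero) τ hτ
    have hd' : DifferentiableWithinAt ℝ (X i k) (Ici 0) τ :=
      hd.mono_of_mem_nhdsWithin (by
        rw [mem_nhdsWithin]
        exact ⟨Iio T, isOpen_Iio, hτ.2, fun x hx => ⟨hx.2, hx.1⟩⟩)
    rw [← hmot i k τ hτ.1 hτ.2]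
    exact hd'.hasDerivWithinAt
  have hampI : ∀ (j : ℤ), ∀ t ∈ Ico (0 : ℝ) T, ‖shellVec X j t‖ ≤ B * ν ^ j := fun j t ht => hamp j t ht.1 ht.2
  -- the improved envelope above `k₁`: `b 0 = B ν^{k₁}`, `b (n+1) = c₀ θ^{k₁+n+1} (b n)²`; its normalised
  -- amplitudes `c₀ θ^{k₁+n+2} b n` square at each step from a seed `≤ δ`, so `W^{k₁+n} b n` stays bounded
  set b : ℕ → ℝ := fun n => Nat.rec (motive := fun _ => ℝ) (B * ν ^ k₁)
    (fun n bn => c₀ * θ ^ (k₁ + n + 1) * bn ^ 2) n with hb_def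
  have hb0 : b 0 = B * ν ^ k₁ := rfl
  have hbs : ∀ n, b (n + 1) = c₀ * θ ^ (k₁ + n + 1) * b n ^ 2 := fun n => rfl
  clear_value b
  have hb_nonneg : ∀ n, 0 ≤ b n := fun n => by
    induction n with
    | zero => rw [hb0]; positivity
    | succ n _ => rw [hbs]; positivity
  have hclaim : ∀ n : ℕ, ∀ t ∈ Ico (0 : ℝ) T, ‖shellVec X ((k₁ + n : ℕ) : ℤ) t‖ ≤ b n := fun n => by
    induction n with
    | zero =>
      intro t ht
      rw [hb0, Nat.add_zero]
      simpa only [zpow_natCast] using hampI (k₁ : ℤ) t ht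
    | succ n ih =>
      intro t ht
      have hk0 : ¬ ((k₁ : ℤ) + ((n : ℤ) + 1) = 0) := by omega
      have hkm1 : ((k₁ + (n + 1) : ℕ) : ℤ) - 1 = ((k₁ + n : ℕ) : ℤ) := by push_cast; ring
      have hkp1 : ((k₁ + (n + 1) : ℕ) : ℤ) + 1 = ((k₁ + (n + 1) + 1 : ℕ) : ℤ) := by push_cast; ring
      have h0 : shellVec X ((k₁ + (n + 1) : ℕ) : ℤ) 0 = 0 := by ext i; simp [shellVec, hinit, hk0]
      have hβ' : ∀ s ∈ Ico (0 : ℝ) T, ‖shellVec X (((k₁ + (n + 1) : ℕ) : ℤ) - 1) s‖ ≤ b n :=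
        fun s hs => by rw [hkm1]; exact ih s hs
      have hγ' : ∀ s ∈ Ico (0 : ℝ) T,
          ‖shellVec X (((k₁ + (n + 1) : ℕ) : ℤ) + 1) s‖ ≤ B * ν ^ (((k₁ + (n + 1) : ℕ) : ℤ) + 1) :=
        fun s hs => hampI _ s hs
      have hdamp' : 2 * bigLam ε₀ ^ ((k₁ + (n + 1) : ℕ) : ℤ) * shiftConst α (0, 0, 1) *
          (B * ν ^ (((k₁ + (n + 1) : ℕ) : ℤ) + 1)) ≤ visc * (1 + ε₀) ^ ((2 : ℝ) * (((k₁ + (n + 1) : ℕ) : ℤ) : ℝ)) := by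
        rw [hkp1, zpow_natCast, zpow_natCast, hPk, hΛθ, mul_pow, pow_succ]
        have hPK : 0 ≤ P ^ (k₁ + (n + 1)) := pow_nonneg hP.le _
        have e1 : 2 * (θ ^ (k₁ + (n + 1)) * P ^ (k₁ + (n + 1))) * shiftConst α (0, 0, 1) *
            (B * (ν ^ (k₁ + (n + 1)) * ν)) =
            (2 * shiftConst α (0, 0, 1) * B * ν * ρ ^ (k₁ + (n + 1))) * P ^ (k₁ + (n + 1)) := by
          rw [hρ_def, mul_pow]; ring
        rw [e1]
        have e2 : 2 * shiftConst α (0, 0, 1) * B * ν * ρ ^ (k₁ + (n + 1)) ≤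
            2 * C * B * ν * ρ ^ (k₁ + (n + 1)) := by
          have hq : 0 ≤ 2 * B * ν * ρ ^ (k₁ + (n + 1)) := by positivity
          nlinarith [mul_le_mul_of_nonneg_right hSC hq]
        calc (2 * shiftConst α (0, 0, 1) * B * ν * ρ ^ (k₁ + (n + 1))) * P ^ (k₁ + (n + 1))
            ≤ (2 * C * B * ν * ρ ^ (k₁ + (n + 1))) * P ^ (k₁ + (n + 1)) :=
              mul_le_mul_of_nonneg_right e2 hPK
          _ ≤ visc * P ^ (k₁ + (n + 1)) :=
              mul_le_mul_of_nonneg_right (hk₁damp (k₁ + (n + 1)) (Nat.le_add_right _ _)) hPK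
      have hstep := norm_shellVec_le_of_dampedShell hε hvisc hc (fun i => hder i _) h0 hβ' hγ' hdamp' t ht
      calc ‖shellVec X ((k₁ + (n + 1) : ℕ) : ℤ) t‖
          ≤ 2 * (bigLam ε₀ ^ (((k₁ + (n + 1) : ℕ) : ℤ) - 1) * shiftConst α (0, 0, 1) * b n ^ 2) /
              (visc * (1 + ε₀) ^ ((2 : ℝ) * (((k₁ + (n + 1) : ℕ) : ℤ) : ℝ))) := hstep
        _ ≤ 2 * (bigLam ε₀ ^ (((k₁ + (n + 1) : ℕ) : ℤ) - 1) * C * b n ^ 2) /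
              (visc * (1 + ε₀) ^ ((2 : ℝ) * (((k₁ + (n + 1) : ℕ) : ℤ) : ℝ))) := by
            gcongr
        _ = b (n + 1) := by
            rw [hbs n, hkm1, zpow_natCast, hPk, hc₀_def, hΛθ, mul_pow]
            field_simp
            ring
  have hu : ∀ n : ℕ, c₀ * θ ^ (k₁ + n + 2) * b n ≤ δ ^ (n + 1) := fun n => by
    induction n with
    | zero =>
      rw [hb0, Nat.add_zero, zero_add, pow_one]
      calc c₀ * θ ^ (k₁ + 2) * (B * ν ^ k₁) = c₀ * θ ^ 2 * B * ρ ^ k₁ := by rw [hρ_def, mul_pow]; ring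
        _ ≤ δ := hk₁seed
    | succ n ih =>
      have hun : 0 ≤ c₀ * θ ^ (k₁ + n + 2) * b n :=
        mul_nonneg (mul_nonneg hc₀.le (pow_nonneg hθ.le _)) (hb_nonneg n)
      have heq : c₀ * θ ^ (k₁ + (n + 1) + 2) * b (n + 1) = (c₀ * θ ^ (k₁ + n + 2) * b n) ^ 2 := by
        rw [hbs]; ring
      rw [heq]
      calc (c₀ * θ ^ (k₁ + n + 2) * b n) ^ 2 ≤ (δ ^ (n + 1)) ^ 2 := pow_le_pow_left₀ hun ih 2
        _ = δ ^ (2 * n + 2) := by rw [← pow_mul]; ring_nf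
        _ ≤ δ ^ (n + 1 + 1) := pow_le_pow_of_le_one hδ.le hδ1 (by omega)
  have hhigh : ∀ n : ℕ, W ^ (k₁ + n) * b n ≤ W ^ k₁ / (c₀ * θ ^ (k₁ + 2)) := by
    intro n
    have hpos : 0 < c₀ * θ ^ (k₁ + n + 2) := by positivity
    have h1 : c₀ * θ ^ (k₁ + n + 2) * (W ^ (k₁ + n) * b n) ≤ W ^ (k₁ + n) * δ ^ (n + 1) := by
      calc c₀ * θ ^ (k₁ + n + 2) * (W ^ (k₁ + n) * b n)
          = W ^ (k₁ + n) * (c₀ * θ ^ (k₁ + n + 2) * b n) := by ring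
        _ ≤ W ^ (k₁ + n) * δ ^ (n + 1) := mul_le_mul_of_nonneg_left (hu n) (by positivity)
    have h2 : W ^ (k₁ + n) * δ ^ (n + 1) ≤ W ^ k₁ * θ ^ n := by
      rw [pow_add, pow_succ]
      calc W ^ k₁ * W ^ n * (δ ^ n * δ) = W ^ k₁ * ((W * δ) ^ n * δ) := by rw [mul_pow]; ring
        _ ≤ W ^ k₁ * (θ ^ n * 1) := by
            refine mul_le_mul_of_nonneg_left ?_ (by positivity)
            exact mul_le_mul (pow_le_pow_left₀ (by positivity) hδW n) hδ1 hδ.le (pow_nonneg hθ.le n)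
        _ = W ^ k₁ * θ ^ n := by ring
    have h3 : W ^ (k₁ + n) * b n ≤ W ^ k₁ * θ ^ n / (c₀ * θ ^ (k₁ + n + 2)) := by
      rw [le_div_iff₀' hpos]; exact h1.trans h2
    exact h3.trans (le_of_eq (by field_simp; ring))
  refine ⟨2 * (W ^ k₁ / (c₀ * θ ^ (k₁ + 2)) + W ^ k₁ * B), fun t ht htT i n => ?_⟩
  have hM1 : 0 ≤ W ^ k₁ / (c₀ * θ ^ (k₁ + 2)) := by positivity
  have hM2 : 0 ≤ W ^ k₁ * B := by positivity
  rcases lt_or_ge n 0 with hn | hn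
  · rw [hlow i n t hn, abs_zero, mul_zero]; positivity
  · obtain ⟨k, rfl⟩ := Int.eq_ofNat_of_zero_le hn
    have hcomp : |X i (k : ℤ) t| ≤ ‖shellVec X (k : ℤ) t‖ := by
      rw [← shellVec_apply X (k : ℤ) t i]; exact abs_apply_le_norm _ _
    have hWk1 : 1 + (1 + ε₀) ^ ((10 : ℝ) * ((k : ℤ) : ℝ)) ≤ 2 * W ^ k := by
      rw [hWk]; linarith [one_le_pow₀ (n := k) hW]
    rcases lt_or_ge k k₁ with hk | hk
    · have h1 : ‖shellVec X (k : ℤ) t‖ ≤ B := by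
        have h := hampI (k : ℤ) t ⟨ht, htT⟩
        rw [zpow_natCast] at h
        exact h.trans (mul_le_of_le_one_right hB (pow_le_one₀ hν.le hν1))
      have h2 : W ^ k ≤ W ^ k₁ := pow_le_pow_right₀ hW hk.le
      calc (1 + (1 + ε₀) ^ ((10 : ℝ) * ((k : ℤ) : ℝ))) * |X i (k : ℤ) t|
          ≤ 2 * W ^ k * B := mul_le_mul hWk1 (hcomp.trans h1) (abs_nonneg _) (by positivity)
        _ ≤ 2 * W ^ k₁ * B := by gcongr
        _ ≤ 2 * (W ^ k₁ / (c₀ * θ ^ (k₁ + 2)) + W ^ k₁ * B) := by linarith [hM1]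
    · obtain ⟨n, rfl⟩ := Nat.exists_eq_add_of_le hk
      have h1 : ‖shellVec X ((k₁ + n : ℕ) : ℤ) t‖ ≤ b n := hclaim n t ⟨ht, htT⟩
      calc (1 + (1 + ε₀) ^ ((10 : ℝ) * (((k₁ + n : ℕ) : ℤ) : ℝ))) * |X i ((k₁ + n : ℕ) : ℤ) t|
          ≤ 2 * W ^ (k₁ + n) * b n := mul_le_mul hWk1 (hcomp.trans h1) (abs_nonneg _) (by positivity)
        _ = 2 * (W ^ (k₁ + n) * b n) := by ring
        _ ≤ 2 * (W ^ k₁ / (c₀ * θ ^ (k₁ + 2))) := mul_le_mul_of_nonneg_left (hhigh n) (by norm_num)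
        _ ≤ 2 * (W ^ k₁ / (c₀ * θ ^ (k₁ + 2)) + W ^ k₁ * B) := by linarith [hM2]

/-- **ROBUST BLOW-UP ⇒ NO SUB-(S₁) AMPLITUDE CEILING ON ANY VISCOUS COMPANION.** If `NoGlobalCascade ε₀ α X₀`
(`ε₀ > 0`, `α ∈ E₂(R)`, any `m`), there is `κ > 0` such that for every viscosity `0 < ν̂ ≤ κ/√2` the maximal
`ν̂`-viscous flow from the one-shell datum (`maximalViscousFlow_of_noGlobalCascade`: `C¹` on `[0,T)`, datum, no
shells below `0`, viscous motion, (4.5) norm unbounded on `[0,T)`) EXCEEDS every geometric envelope `B ν^j`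
with `0 < ν`, `(1+ε₀) ν² < 1` somewhere: `‖x_j(t)‖ > B ν^j`. The fronts of a Theorem-4.2-robust blow-up keep,
along every viscous companion, at least the (S₁) amplitude rate `(1+ε₀)^{-j/2}` (limsup sense) — the lower edge
of the window `(1+ε₀)⁻¹ ≤ ν²` of the front bundle (`eternal_surviving_one_of_front`) is forced by dissipation.
[cite: Tao2016AveragedNS, §4 Thm. 4.2 and the viscous equation before Thm. 4.2, Lemma 4.1 (4.5); Teschl2012, §2.6 Cor. 2.16 (maximal solutions); Cheskidov2008, §4 (analogy)] -/
theorem noSubcriticalCeiling_of_noGlobalCascade {ε₀ R : ℝ} (hε : 0 < ε₀)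
    {α : Fin m → Fin m → Fin m → ℤ × ℤ × ℤ → ℝ} {X₀ : Fin m → ℝ} (hα : InTableClass R α)
    (hNG : NoGlobalCascade ε₀ α X₀) :
    ∃ κ : ℝ, 0 < κ ∧ ∀ visc : ℝ, 0 < visc → visc * Real.sqrt 2 ≤ κ →
      ∃ (T : ℝ) (X : Fin m → ℤ → ℝ → ℝ), 0 < T ∧
        (∀ i n, ContDiffOn ℝ 1 (X i n) (Set.Ico 0 T)) ∧
        (∀ i n, X i n 0 = if n = 0 then X₀ i else 0) ∧
        (∀ i n t, n < 0 → X i n t = 0) ∧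
        (∀ i n t, 0 ≤ t → t < T → derivWithin (X i n) (Set.Ici 0) t =
          quadTerm ε₀ α X i n t - visc * (1 + ε₀) ^ ((2 : ℝ) * n) * X i n t) ∧
        (∀ M : ℝ, ∃ t : ℝ, 0 ≤ t ∧ t < T ∧
          ∃ (i : Fin m) (n : ℤ), M < (1 + (1 + ε₀) ^ ((10 : ℝ) * n)) * |X i n t|) ∧
        ∀ B ν : ℝ, 0 < ν → (1 + ε₀) * ν ^ 2 < 1 →
          ∃ (j : ℤ) (t : ℝ), 0 ≤ t ∧ t < T ∧ B * ν ^ j < ‖shellVec X j t‖ := by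
  obtain ⟨κ, hκ, H⟩ := maximalViscousFlow_of_noGlobalCascade hε hα hNG
  refine ⟨κ, hκ, fun visc hvisc hvk => ?_⟩
  obtain ⟨T, X, hT, h1, h2, h3, h4, -, h6⟩ := H visc hvisc.le hvk
  refine ⟨T, X, hT, h1, h2, h3, h4, h6, fun B ν hν hsub => ?_⟩
  by_contra hcon
  push Not at hcon
  obtain ⟨M, hM⟩ := weight45_bounded_of_subcriticalCeiling hε hvisc hα.2.1 h1 h2 h3 h4 hν hsub
    (fun j t ht htT => hcon j t ht htT)
  obtain ⟨t, ht0, htT, i, n, hlt⟩ := h6 M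
  exact absurd (hM t ht0 htT i n) (not_le.2 hlt)

end BlowupRigidityOne

end Summit.NavierStokesRegularity.NavierStokesRegularity.Theorems

end
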